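import Summits.Ventures.HSemireg.Mod4MiddleMatrixSquareRoot
import Summits.Ventures.HSemireg.Mod4SiteSigns

/-!
# Venture HSemireg — MOD-4 line: the alternating-sign convention does not change the middle-degree kernel dimensions
# (`M_f(q̃) = S·M_f(q)·S`, `S = diag(−1)^a`, hence `dim ker(M_f(q̃) − c) = dim ker(M_f(q) − c)`)

HONEST FRAMING. Part of the Lean index of the computation cell `pub-hsemireg` (widening group W3, seat w3-mod4-1 gen 5; file of
record `HOME/widen/W3/MOD4-OFFSPLIT-w3mod4.md` §11.6).  EXPLICIT MATRICES over a commutative ring / field ONLY: no abelian variety,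
no sheaf, no Ext group, no semiregularity map; nothing here says that HC, HC_CM or HC_AV holds; no Literature fact is declared or
used.  th-7's Weil model writes the h-part with the alternating coefficient sequence `q̃_i = (−1)^i q_i` (MOD4-OFFSPLIT §10.1 / §11.1),
so `Mod4Site.middle_degree_rank` (Mod4MiddleDegree.lean) is stated with `Mod4.middleM n q̃`.  HERE: `middleM_alt` — for every `n`,
`q` and every commutative ring, `middleM n q̃ = signS n * middleM n q * signS n` (`signS = diag (−1)^a`, seat g4's matrix), and
`finrank_ker_middleM_alt` — over a field, `dim ker(middleM n q̃ − c) = dim ker(middleM n q − c)` for every `c` (conjugation by the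
involution `S`).  So the kernel term of `middle_degree_rank` is THEOREM R_f's `dim ker(M_f − αβ)` on the nose.
All statements and proofs: w3-mod4-1 g5 (2026-08-23).  Namespace `Summit.Ventures.HSemireg.Mod4Site`.
-/

namespace Summit.Ventures.HSemireg.Mod4Site

open Matrix Summit.Ventures.HSemireg.Mod4

section Ring

variable {R : Type*} [CommRing R]

/-- parity bookkeeping: `(−1)^{(n−a+m)+(n−m+b)} = (−1)^a·(−1)^b` for `a, m ≤ n`. -/
lemma neg_one_pow_shift {n a b m : ℕ} (ha : a ≤ n) (hm : m ≤ n) :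
    ((-1 : R) ^ (n - a + m)) * (-1 : R) ^ (n - m + b) = (-1 : R) ^ a * (-1 : R) ^ b := by
  rw [← pow_add, ← pow_add, neg_one_pow_eq_pow_mod_two, neg_one_pow_eq_pow_mod_two (a + b)]
  congr 1
  omega

/-- **`M_f(q̃) = S·M_f(q)·S`** with `q̃_i = (−1)^i q_i` and `S = diag(−1)^a`. -/
theorem middleM_alt (n : ℕ) (q : ℕ → R) :
    middleM n (fun i => (-1 : R) ^ i * q i) = signS n * middleM n q * signS n := by
  ext a b
  simp only [middleM, signS, Matrix.mul_diagonal, Matrix.diagonal_mul, Finset.mul_sum, Finset.sum_mul]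
  refine Finset.sum_congr rfl fun m _ => ?_
  have h := neg_one_pow_shift (R := R) (n := n) (a := a) (b := b) (m := m) (Nat.le_of_lt_succ a.is_lt)
    (Nat.le_of_lt_succ m.is_lt)
  linear_combination ((-1 : R) ^ (n + (b : ℕ)) * (n.choose (b : ℕ) : R) * ((-1 : R) ^ (m : ℕ) * (n.choose (m : ℕ) : R)) *
    q (n - (a : ℕ) + (m : ℕ)) * q (n - (m : ℕ) + (b : ℕ))) * h

/-- `S² = 1`. -/
lemma signS_mul_signS (n : ℕ) : (signS n : Matrix (Fin (n + 1)) (Fin (n + 1)) R) * signS n = 1 := by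
  simp only [signS, diagonal_mul_diagonal, ← pow_add, ← two_mul, pow_mul, neg_one_sq, one_pow, diagonal_one]

end Ring

section Field

variable {K : Type*} [Field K]

/-- conjugation by the involution `S` preserves the kernel dimensions of `X − c`. -/
lemma finrank_ker_conj_signS (n : ℕ) (M : Matrix (Fin (n + 1)) (Fin (n + 1)) K) (c : K) :
    Module.finrank K (LinearMap.ker (Matrix.toLin' (signS n * M * signS n) - c • LinearMap.id)) =
      Module.finrank K (LinearMap.ker (Matrix.toLin' M - c • LinearMap.id)) := by
  have hS : (signS n : Matrix (Fin (n + 1)) (Fin (n + 1)) K) * signS n = 1 := signS_mul_signS n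
  have hT : ∀ X : Matrix (Fin (n + 1)) (Fin (n + 1)) K,
      Matrix.toLin' X - c • LinearMap.id = Matrix.toLin' (X - c • (1 : Matrix (Fin (n + 1)) (Fin (n + 1)) K)) := fun X => by
    rw [map_sub, map_smul, Matrix.toLin'_one]
  have key : signS n * M * signS n - c • (1 : Matrix (Fin (n + 1)) (Fin (n + 1)) K) =
      signS n * (M - c • (1 : Matrix (Fin (n + 1)) (Fin (n + 1)) K)) * signS n := by
    rw [Matrix.mul_sub, Matrix.sub_mul, Matrix.mul_smul, Matrix.smul_mul, Matrix.mul_one, hS]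
  -- `toLin' S` is an involution, hence an equivalence
  let e : (Fin (n + 1) → K) ≃ₗ[K] (Fin (n + 1) → K) :=
    LinearEquiv.ofLinear (Matrix.toLin' (signS n)) (Matrix.toLin' (signS n))
      (by rw [← Matrix.toLin'_mul, hS, Matrix.toLin'_one]) (by rw [← Matrix.toLin'_mul, hS, Matrix.toLin'_one])
  have he : (e : (Fin (n + 1) → K) →ₗ[K] (Fin (n + 1) → K)) = Matrix.toLin' (signS n) := rfl
  rw [hT, hT, key, Matrix.toLin'_mul, Matrix.toLin'_mul, ← he, LinearMap.ker_comp,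
    LinearMap.ker_comp_of_ker_eq_bot _ (LinearEquiv.ker e), Submodule.comap_equiv_eq_map_symm, LinearEquiv.finrank_map_eq]

/-- **the kernel term of `middle_degree_rank` is THEOREM R_f's:** `dim ker(M_f(q̃) − c) = dim ker(M_f(q) − c)` for every `c`. -/
theorem finrank_ker_middleM_alt (n : ℕ) (q : ℕ → K) (c : K) :
    Module.finrank K (LinearMap.ker (Matrix.toLin' (middleM n (fun i => (-1 : K) ^ i * q i)) - c • LinearMap.id)) =
      Module.finrank K (LinearMap.ker (Matrix.toLin' (middleM n q) - c • LinearMap.id)) := by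
  rw [middleM_alt, finrank_ker_conj_signS]

end Field

end Summit.Ventures.HSemireg.Mod4Site
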